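import Summits.CriticalPhenomena.PercolationContinuityZ3.Theorems.PercNearOneGluingNoHeavyLowerTailSahiCombFiveUpSetRankZ3

/-!
# The two-copy certificate Σ for `TRI_W(2)`: its D-part (the eight L/R classes with the Σ directions) is linearly independent

Support file of the one-cut programme (crux `NoHeavyLowerTail`, stmt-CriticalPhenomena-4575; TRI lane of cell `prim-masterthm`; seat prim-lf-1 gen 21;
memo `FROM-prim-lf-1-gen21-CLOSURE.md` §11 and the explicit certificate Σ of `…SahiCombTriWCertificate` (`certSigmaWeight`, conjecture
`CertSigmaKernelZero`)).

The explicit `a = 2` certificate Σ has rows for three token types.  Its D-PART consists of the eight classes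
`L_x = F_x ∩ refl(G_x̄)` and `R_x = G_x̄ ∩ refl(F_x)` (`x` in the square `{0, p, q, 1}`, `p̄ = q`, `0̄ = 1`), all placed at level `x`
(the F-index gauge), with the Σ directions by level: `L ↦ (e₁+e₂, e₂, e₂, e₁)`, `R ↦ (e₁, e₁+e₂, e₁+e₂, e₂)` for `x = 0, p, q, 1`.
So copy 1 carries `L_0, L_1, R_0, R_p, R_q` and copy 2 carries `L_0, L_p, L_q, R_p, R_q, R_1`, and a token at level `x` is seen by the supply
fibres `U_y = F_y ∩ G_y`, `y ⊇ x`.  As in `rankZ3_kernel_eq_zero` (the analogous statement for p5's CERT-Z with the harmonic directions) the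
index square is presented by eight up-sets `F₀ ⊆ Fp, Fq ⊆ F₁`, `G₀ ⊆ Gp, Gq ⊆ G₁`, and the R-classes are named by their G-index
(`g1 = R_0` on `G₁ ∩ refl F₀`, `gq = R_p` on `Gq ∩ refl Fp`, `gp = R_q` on `Gp ∩ refl Fq`, `g0 = R_1` on `G₀ ∩ refl F₁`).

* **`sigma3_kernel_eq_zero`** — if the eight coefficient vectors satisfy the eight levelled equations of the D-part of Σ (fibre `0`:
  `Z b0 + Z g1 = 0` and `Z b0 = 0`; fibre `p`: `Z b0 + Z g1 + Z gq = 0` and `Z b0 + Z bp + Z gq = 0`; fibre `q` symmetrically; top fibre: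
  `Z b0 + Z b1 + Z g1 + Z gq + Z gp = 0` and `Z b0 + Z bp + Z bq + Z gq + Z gp + Z g0 = 0`), then all eight vanish.
  PROOF (found with the type-level 'support-calculus' engine of the memo, then written by hand; four stages, only point supports, the
  antipodal extension lemma `zsum_ext` and C2′ `eq_zero_of_zsum_eq_zero_on`): Stage A fibre `0`; Stage B on `F₁ ∩ G₀` kills `b1, g0`;
  Stage C on `F₀ ∩ G₁` kills `b0, g1`; Stage D kills the four middle classes directly by C2′ (no RANK-Z call is needed, unlike (Z3)).
What this is NOT: the K-part of Σ (the `refl(U_x)` tokens with their `T4` tags) is not treated, so this file does not prove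
`CertSigmaKernelZero` or `TriWIneq`; by the memo's §11 the K-part reduces, uniformly, to ONE global lemma about the top K-class on the
'corner' tokens (KEY), which is open. [this work]
-/

namespace Summit.CriticalPhenomena.PercolationContinuityZ3.Theorems

namespace FiveUpSet

open Finset

variable {α : Type} [DecidableEq α] [Fintype α]

/-- **(Σ3): the D-part of the certificate Σ is linearly independent** (kernel form).  Eight up-sets `F₀ ⊆ Fp, Fq ⊆ F₁`,
`G₀ ⊆ Gp, Gq ⊆ G₁`; coefficient vectors `b0` on `F₀ ∩ refl G₁`, `bp` on `Fp ∩ refl Gq`, `bq` on `Fq ∩ refl Gp`, `b1` on `F₁ ∩ refl G₀`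
(the classes `L_0, L_p, L_q, L_1`) and `g1` on `G₁ ∩ refl F₀`, `gq` on `Gq ∩ refl Fp`, `gp` on `Gp ∩ refl Fq`, `g0` on `G₀ ∩ refl F₁`
(the classes `R_0, R_p, R_q, R_1`); the levelled two-copy equations of Σ restricted to these classes:
fibre `0` (`t ∈ F₀ ∩ G₀`): `Z b0 + Z g1 = 0` (copy 1), `Z b0 = 0` (copy 2); fibre `p` (`t ∈ Fp ∩ Gp`): `Z b0 + Z g1 + Z gq = 0`,
`Z b0 + Z bp + Z gq = 0`; fibre `q` (`t ∈ Fq ∩ Gq`): `Z b0 + Z g1 + Z gp = 0`, `Z b0 + Z bq + Z gp = 0`; top fibre (`t ∈ F₁ ∩ G₁`):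
`Z b0 + Z b1 + Z g1 + Z gq + Z gp = 0`, `Z b0 + Z bp + Z bq + Z gq + Z gp + Z g0 = 0`.  Then all eight vectors are zero. [this work] -/
theorem sigma3_kernel_eq_zero (F₀ Fp Fq F₁ G₀ Gp Gq G₁ : Finset (Finset α))
    (hF₀ : IsUpperSet (F₀ : Set (Finset α))) (hFp : IsUpperSet (Fp : Set (Finset α))) (hFq : IsUpperSet (Fq : Set (Finset α)))
    (hF₁ : IsUpperSet (F₁ : Set (Finset α))) (hG₀ : IsUpperSet (G₀ : Set (Finset α))) (hGp : IsUpperSet (Gp : Set (Finset α)))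
    (hGq : IsUpperSet (Gq : Set (Finset α))) (hG₁ : IsUpperSet (G₁ : Set (Finset α)))
    (hF0p : F₀ ⊆ Fp) (hF0q : F₀ ⊆ Fq) (hFp1 : Fp ⊆ F₁) (hFq1 : Fq ⊆ F₁)
    (hG0p : G₀ ⊆ Gp) (hG0q : G₀ ⊆ Gq) (hGp1 : Gp ⊆ G₁) (hGq1 : Gq ⊆ G₁)
    (b0 bp bq b1 g1 gq gp g0 : Finset α → ℚ)
    (sb0 : ∀ d, b0 d ≠ 0 → d ∈ F₀ ∧ dᶜ ∈ G₁) (sbp : ∀ d, bp d ≠ 0 → d ∈ Fp ∧ dᶜ ∈ Gq)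
    (sbq : ∀ d, bq d ≠ 0 → d ∈ Fq ∧ dᶜ ∈ Gp) (sb1 : ∀ d, b1 d ≠ 0 → d ∈ F₁ ∧ dᶜ ∈ G₀)
    (sg1 : ∀ d, g1 d ≠ 0 → d ∈ G₁ ∧ dᶜ ∈ F₀) (sgq : ∀ d, gq d ≠ 0 → d ∈ Gq ∧ dᶜ ∈ Fp)
    (sgp : ∀ d, gp d ≠ 0 → d ∈ Gp ∧ dᶜ ∈ Fq) (sg0 : ∀ d, g0 d ≠ 0 → d ∈ G₀ ∧ dᶜ ∈ F₁)
    (e10 : ∀ t, t ∈ F₀ → t ∈ G₀ → zsum b0 t + zsum g1 t = 0)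
    (e20 : ∀ t, t ∈ F₀ → t ∈ G₀ → zsum b0 t = 0)
    (e1p : ∀ t, t ∈ Fp → t ∈ Gp → zsum b0 t + zsum g1 t + zsum gq t = 0)
    (e2p : ∀ t, t ∈ Fp → t ∈ Gp → zsum b0 t + zsum bp t + zsum gq t = 0)
    (e1q : ∀ t, t ∈ Fq → t ∈ Gq → zsum b0 t + zsum g1 t + zsum gp t = 0)
    (e2q : ∀ t, t ∈ Fq → t ∈ Gq → zsum b0 t + zsum bq t + zsum gp t = 0)
    (e11 : ∀ t, t ∈ F₁ → t ∈ G₁ → zsum b0 t + zsum b1 t + zsum g1 t + zsum gq t + zsum gp t = 0)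
    (e21 : ∀ t, t ∈ F₁ → t ∈ G₁ → zsum b0 t + zsum bp t + zsum bq t + zsum gq t + zsum gp t + zsum g0 t = 0) :
    (∀ d, b0 d = 0) ∧ (∀ d, bp d = 0) ∧ (∀ d, bq d = 0) ∧ (∀ d, b1 d = 0) ∧
      (∀ d, g1 d = 0) ∧ (∀ d, gq d = 0) ∧ (∀ d, gp d = 0) ∧ (∀ d, g0 d = 0) := by
  -- up-set intersections used below
  have hT : IsUpperSet ((F₁ ∩ G₀ : Finset (Finset α)) : Set (Finset α)) := by rw [coe_inter]; exact hF₁.inter hG₀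
  have hT' : IsUpperSet ((F₀ ∩ G₁ : Finset (Finset α)) : Set (Finset α)) := by rw [coe_inter]; exact hF₀.inter hG₁
  -- point supports (the zeta combination of a class vanishes off its support up-set)
  have pb0 : ∀ t, t ∉ F₀ → zsum b0 t = 0 := fun t ht => zsum_eq_zero_of_not_mem hF₀ b0 (fun d hd => (sb0 d hd).1) ht
  have pbp : ∀ t, t ∉ Fp → zsum bp t = 0 := fun t ht => zsum_eq_zero_of_not_mem hFp bp (fun d hd => (sbp d hd).1) ht
  have pbq : ∀ t, t ∉ Fq → zsum bq t = 0 := fun t ht => zsum_eq_zero_of_not_mem hFq bq (fun d hd => (sbq d hd).1) ht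
  have pgq : ∀ t, t ∉ Gq → zsum gq t = 0 := fun t ht => zsum_eq_zero_of_not_mem hGq gq (fun d hd => (sgq d hd).1) ht
  have pgp : ∀ t, t ∉ Gp → zsum gp t = 0 := fun t ht => zsum_eq_zero_of_not_mem hGp gp (fun d hd => (sgp d hd).1) ht
  /- STAGE A (fibre `0`): `Z b0 = 0` on `G₀` (equation of copy 2 on `F₀ ∩ G₀`, point support off `F₀`). -/
  have ab0 : ∀ t, t ∈ G₀ → zsum b0 t = 0 := by
    intro t htG0
    by_cases h0 : t ∈ F₀
    · exact e20 t h0 htG0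
    · exact pb0 t h0
  /- STAGE B on `T = F₁ ∩ G₀`. -/
  -- (B1) `Z g1 = 0` on `T` (antipodal extension from `F₀ ∩ T = F₀ ∩ G₀`, where copy 1 of fibre `0` gives it)
  have bg1 : ∀ t, t ∈ F₁ ∩ G₀ → zsum g1 t = 0 := by
    refine zsum_ext hF₀ hT g1 (fun d hd => (sg1 d hd).2) ?_
    intro t htF0 htT
    have h := e10 t htF0 (mem_inter.1 htT).2
    rw [ab0 t (mem_inter.1 htT).2] at h
    linarith
  -- (B2) on `Fp ∩ T`: `Z gq = 0` and `Z bp = 0`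
  have bgq' : ∀ t, t ∈ Fp → t ∈ F₁ ∩ G₀ → zsum gq t = 0 ∧ zsum bp t = 0 := by
    intro t htFp htT
    have htG0 := (mem_inter.1 htT).2
    have h1 := e1p t htFp (hG0p htG0)
    have h2 := e2p t htFp (hG0p htG0)
    rw [ab0 t htG0, bg1 t htT] at h1
    rw [ab0 t htG0] at h2
    constructor <;> linarith
  -- (B3) `Z gq = 0` on all of `T` (antipodal extension from `Fp ∩ T`), and symmetrically `Z gp = 0` on `T`
  have bgq : ∀ t, t ∈ F₁ ∩ G₀ → zsum gq t = 0 := by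
    refine zsum_ext hFp hT gq (fun d hd => (sgq d hd).2) ?_
    intro t htFp htT
    exact (bgq' t htFp htT).1
  have bgp' : ∀ t, t ∈ Fq → t ∈ F₁ ∩ G₀ → zsum gp t = 0 ∧ zsum bq t = 0 := by
    intro t htFq htT
    have htG0 := (mem_inter.1 htT).2
    have h1 := e1q t htFq (hG0q htG0)
    have h2 := e2q t htFq (hG0q htG0)
    rw [ab0 t htG0, bg1 t htT] at h1
    rw [ab0 t htG0] at h2
    constructor <;> linarith
  have bgp : ∀ t, t ∈ F₁ ∩ G₀ → zsum gp t = 0 := by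
    refine zsum_ext hFq hT gp (fun d hd => (sgp d hd).2) ?_
    intro t htFq htT
    exact (bgp' t htFq htT).1
  -- (B4) `Z bp = Z bq = 0` on `T` (on `Fp` resp. `Fq` by (B2), elsewhere by point support)
  have bbp : ∀ t, t ∈ F₁ ∩ G₀ → zsum bp t = 0 := by
    intro t ht
    by_cases htFp : t ∈ Fp
    · exact (bgq' t htFp ht).2
    · exact pbp t htFp
  have bbq : ∀ t, t ∈ F₁ ∩ G₀ → zsum bq t = 0 := by
    intro t ht
    by_cases htFq : t ∈ Fq
    · exact (bgp' t htFq ht).2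
    · exact pbq t htFq
  -- (B5) the two top equations on `T` now read `Z b1 = 0` and `Z g0 = 0`; C2′ kills `b1` and `g0`
  have fb1 : ∀ d, b1 d = 0 := by
    refine eq_zero_of_zsum_eq_zero_on hF₁ hG₀ b1 sb1 ?_
    intro t htF1 htG0
    have ht : t ∈ F₁ ∩ G₀ := mem_inter.2 ⟨htF1, htG0⟩
    have h := e11 t htF1 (hGp1 (hG0p htG0))
    rw [ab0 t htG0, bg1 t ht, bgq t ht, bgp t ht] at h
    linarith
  have fg0 : ∀ d, g0 d = 0 := by
    refine eq_zero_of_zsum_eq_zero_on hG₀ hF₁ g0 sg0 ?_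
    intro t htG0 htF1
    have ht : t ∈ F₁ ∩ G₀ := mem_inter.2 ⟨htF1, htG0⟩
    have h := e21 t htF1 (hGp1 (hG0p htG0))
    rw [ab0 t htG0, bbp t ht, bbq t ht, bgq t ht, bgp t ht] at h
    linarith
  have zb1 : ∀ t, zsum b1 t = 0 := by
    intro t; unfold zsum; exact Finset.sum_eq_zero fun d _ => by rw [fb1 d, zero_mul]
  have zg0 : ∀ t, zsum g0 t = 0 := by
    intro t; unfold zsum; exact Finset.sum_eq_zero fun d _ => by rw [fg0 d, zero_mul]
  /- STAGE C on `T' = F₀ ∩ G₁`. -/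
  -- (C1) on `T' ∩ Gp ∩ Gq`: everything vanishes
  have c1 : ∀ t, t ∈ F₀ → t ∈ Gp → t ∈ Gq →
      zsum b0 t = 0 ∧ zsum g1 t = 0 ∧ zsum gq t = 0 ∧ zsum gp t = 0 ∧ zsum bp t = 0 ∧ zsum bq t = 0 := by
    intro t htF0 htGp htGq
    have h1p := e1p t (hF0p htF0) htGp
    have h2p := e2p t (hF0p htF0) htGp
    have h1q := e1q t (hF0q htF0) htGq
    have h2q := e2q t (hF0q htF0) htGq
    have h11 := e11 t (hFp1 (hF0p htF0)) (hGp1 htGp)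
    have h21 := e21 t (hFp1 (hF0p htF0)) (hGp1 htGp)
    rw [zb1 t] at h11
    rw [zg0 t] at h21
    refine ⟨by linarith, by linarith, by linarith, by linarith, by linarith, by linarith⟩
  -- (C2) on `T' ∩ Gp \ Gq`: `Z gp = Z gq = Z bq = 0` and `Z b0 + Z bp = 0`
  have c2 : ∀ t, t ∈ F₀ → t ∈ Gp → t ∉ Gq → zsum gp t = 0 ∧ zsum bq t = 0 ∧ zsum b0 t + zsum bp t = 0 := by
    intro t htF0 htGp htGq
    have hgq : zsum gq t = 0 := pgq t htGq
    have h1p := e1p t (hF0p htF0) htGp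
    have h2p := e2p t (hF0p htF0) htGp
    have h11 := e11 t (hFp1 (hF0p htF0)) (hGp1 htGp)
    have h21 := e21 t (hFp1 (hF0p htF0)) (hGp1 htGp)
    rw [zb1 t] at h11
    rw [zg0 t] at h21
    rw [hgq] at h1p h2p h11 h21
    refine ⟨by linarith, by linarith, by linarith⟩
  -- (C3) on `T' ∩ Gq \ Gp`: `Z gq = Z gp = Z bp = 0` and `Z b0 + Z bq = 0`
  have c3 : ∀ t, t ∈ F₀ → t ∈ Gq → t ∉ Gp → zsum gq t = 0 ∧ zsum bp t = 0 ∧ zsum b0 t + zsum bq t = 0 := by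
    intro t htF0 htGq htGp
    have hgp : zsum gp t = 0 := pgp t htGp
    have h1q := e1q t (hF0q htF0) htGq
    have h2q := e2q t (hF0q htF0) htGq
    have h11 := e11 t (hFq1 (hF0q htF0)) (hGq1 htGq)
    have h21 := e21 t (hFq1 (hF0q htF0)) (hGq1 htGq)
    rw [zb1 t] at h11
    rw [zg0 t] at h21
    rw [hgp] at h1q h2q h11 h21
    refine ⟨by linarith, by linarith, by linarith⟩
  -- (C4) `Z bp = 0` on `T'` (antipodal extension from `Gq ∩ T'`), `Z bq = 0` on `T'` (from `Gp ∩ T'`)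
  have cbp : ∀ t, t ∈ F₀ ∩ G₁ → zsum bp t = 0 := by
    refine zsum_ext hGq hT' bp (fun d hd => (sbp d hd).2) ?_
    intro t htGq htT
    have htF0 := (mem_inter.1 htT).1
    by_cases htGp : t ∈ Gp
    · exact (c1 t htF0 htGp htGq).2.2.2.2.1
    · exact (c3 t htF0 htGq htGp).2.1
  have cbq : ∀ t, t ∈ F₀ ∩ G₁ → zsum bq t = 0 := by
    refine zsum_ext hGp hT' bq (fun d hd => (sbq d hd).2) ?_
    intro t htGp htT
    have htF0 := (mem_inter.1 htT).1
    by_cases htGq : t ∈ Gq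
    · exact (c1 t htF0 htGp htGq).2.2.2.2.2
    · exact (c2 t htF0 htGp htGq).2.1
  -- (C5) hence `Z b0 = 0` and `Z g1 = 0` on `T'`; C2′ kills `b0` and `g1`
  have cb0 : ∀ t, t ∈ F₀ ∩ G₁ → zsum b0 t = 0 := by
    intro t ht
    have htF0 := (mem_inter.1 ht).1
    have htG1 := (mem_inter.1 ht).2
    by_cases htGp : t ∈ Gp
    · by_cases htGq : t ∈ Gq
      · exact (c1 t htF0 htGp htGq).1
      · have h := (c2 t htF0 htGp htGq).2.2
        rw [cbp t ht] at h
        linarith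
    · by_cases htGq : t ∈ Gq
      · have h := (c3 t htF0 htGq htGp).2.2
        rw [cbq t ht] at h
        linarith
      · have h := e21 t (hFp1 (hF0p htF0)) htG1
        rw [zg0 t, cbp t ht, cbq t ht, pgq t htGq, pgp t htGp] at h
        linarith
  have cg1 : ∀ t, t ∈ F₀ ∩ G₁ → zsum g1 t = 0 := by
    intro t ht
    have htF0 := (mem_inter.1 ht).1
    have htG1 := (mem_inter.1 ht).2
    have h := e11 t (hFp1 (hF0p htF0)) htG1
    have hgq : zsum gq t = 0 := by
      by_cases htGp : t ∈ Gp
      · by_cases htGq : t ∈ Gq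
        · exact (c1 t htF0 htGp htGq).2.2.1
        · exact pgq t htGq
      · by_cases htGq : t ∈ Gq
        · exact (c3 t htF0 htGq htGp).1
        · exact pgq t htGq
    have hgp : zsum gp t = 0 := by
      by_cases htGq : t ∈ Gq
      · by_cases htGp : t ∈ Gp
        · exact (c1 t htF0 htGp htGq).2.2.2.1
        · exact pgp t htGp
      · by_cases htGp : t ∈ Gp
        · exact (c2 t htF0 htGp htGq).1
        · exact pgp t htGp
    rw [zb1 t, cb0 t ht, hgq, hgp] at h
    linarith
  have fb0 : ∀ d, b0 d = 0 := by
    refine eq_zero_of_zsum_eq_zero_on hF₀ hG₁ b0 sb0 ?_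
    intro t htF0 htG1
    exact cb0 t (mem_inter.2 ⟨htF0, htG1⟩)
  have fg1 : ∀ d, g1 d = 0 := by
    refine eq_zero_of_zsum_eq_zero_on hG₁ hF₀ g1 sg1 ?_
    intro t htG1 htF0
    exact cg1 t (mem_inter.2 ⟨htF0, htG1⟩)
  have zb0 : ∀ t, zsum b0 t = 0 := by
    intro t; unfold zsum; exact Finset.sum_eq_zero fun d _ => by rw [fb0 d, zero_mul]
  have zg1 : ∀ t, zsum g1 t = 0 := by
    intro t; unfold zsum; exact Finset.sum_eq_zero fun d _ => by rw [fg1 d, zero_mul]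
  /- STAGE D: the four middle classes, directly by C2′. -/
  -- `gq = 0`: on `Gq ∩ Fp`, either `t ∈ Gp` (fibre `p`, copy 1) or `t ∉ Gp` (top fibre, copy 1, point support of `gp`)
  have fgq : ∀ d, gq d = 0 := by
    refine eq_zero_of_zsum_eq_zero_on hGq hFp gq sgq ?_
    intro t htGq htFp
    by_cases htGp : t ∈ Gp
    · have h := e1p t htFp htGp
      rw [zb0 t, zg1 t] at h
      linarith
    · have h := e11 t (hFp1 htFp) (hGq1 htGq)
      rw [zb0 t, zb1 t, zg1 t, pgp t htGp] at h
      linarith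
  have fgp : ∀ d, gp d = 0 := by
    refine eq_zero_of_zsum_eq_zero_on hGp hFq gp sgp ?_
    intro t htGp htFq
    by_cases htGq : t ∈ Gq
    · have h := e1q t htFq htGq
      rw [zb0 t, zg1 t] at h
      linarith
    · have h := e11 t (hFq1 htFq) (hGp1 htGp)
      rw [zb0 t, zb1 t, zg1 t, pgq t htGq] at h
      linarith
  have zgq : ∀ t, zsum gq t = 0 := by
    intro t; unfold zsum; exact Finset.sum_eq_zero fun d _ => by rw [fgq d, zero_mul]
  have zgp : ∀ t, zsum gp t = 0 := by
    intro t; unfold zsum; exact Finset.sum_eq_zero fun d _ => by rw [fgp d, zero_mul]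
  -- `bp = 0`: on `Fp ∩ Gq`, either `t ∈ Gp` (fibre `p`, copy 2) or not (top fibre, copy 2, with `Z bq t = 0` from fibre `q` or point support)
  have fbp : ∀ d, bp d = 0 := by
    refine eq_zero_of_zsum_eq_zero_on hFp hGq bp sbp ?_
    intro t htFp htGq
    by_cases htGp : t ∈ Gp
    · have h := e2p t htFp htGp
      rw [zb0 t, zgq t] at h
      linarith
    · have hbq : zsum bq t = 0 := by
        by_cases htFq : t ∈ Fq
        · have h := e2q t htFq htGq
          rw [zb0 t, zgp t] at h
          linarith
        · exact pbq t htFq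
      have h := e21 t (hFp1 htFp) (hGq1 htGq)
      rw [zb0 t, hbq, zgq t, zgp t, zg0 t] at h
      linarith
  have fbq : ∀ d, bq d = 0 := by
    refine eq_zero_of_zsum_eq_zero_on hFq hGp bq sbq ?_
    intro t htFq htGp
    by_cases htGq : t ∈ Gq
    · have h := e2q t htFq htGq
      rw [zb0 t, zgp t] at h
      linarith
    · have hbp : zsum bp t = 0 := by
        by_cases htFp : t ∈ Fp
        · have h := e2p t htFp htGp
          rw [zb0 t, zgq t] at h
          linarith
        · exact pbp t htFp
      have h := e21 t (hFq1 htFq) (hGp1 htGp)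
      rw [zb0 t, hbp, zgq t, zgp t, zg0 t] at h
      linarith
  exact ⟨fb0, fbp, fbq, fb1, fg1, fgq, fgp, fg0⟩

end FiveUpSet

end Summit.CriticalPhenomena.PercolationContinuityZ3.Theorems
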